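import Summits.HodgeConjecture.HodgeConjecture.Cruxes.BlochSeedDiscOne.RingTwoMassLaw

/-!
# Shell-3 face of the dual certificate family, III: THE CELL-WEIGHT LAW AND THE P-MASS FLOOR `13·(−E) ≤ 8·Σ_P m`

`line stmt-HodgeConjecture-18881 Cruxes/BlochSeedDiscOne/Lines/birth.lean 814a6a70c14e831a stub_rung_pad4_seedAt`
(plan-lens-HodgeAV-dual g16, 2026-08-31; companion of `ShellThreePairLaw.lean` v11 @6387f7144c08 and `ShellThreeDoorB.lean`
@72eed19ae9d6).  KERNEL STATEMENTS ONLY — no `sorry`, no new axiom, no `instance`, no `notation`, no `native_decide`.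
**Nothing here is proved toward HC / HC_CM / HC_AV / №4 / 26512 / 18881 / H2.**  The three DISPLAYED BINDERS are support-level
machine facts of OTHER seats, NOT proved here: `HubfreePB` = gs-eng-2 (B) «every hub-free supported P cell at shell 3 is u⁴, Auuu,
AAuu, AAAu, AAAA or Buuu» (check-static BATCH 198 ×1), `NoOffHubfreeP` = (B) ∧ «P Buuu = ∅», `HubfreePAx1` = the (M1)-shape
«P AAuu = AAAu = AAAA = ∅» (hub-free P ⊆ {u⁴, Auuu}; gs-eng-2 G-cascade ∕ hsem-4 door, ×1).  Everything else is clause 1 (`A1`),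
the COARSE RULE D + `Disj`, the alphabet and ring 3 of the shell-3 statement of record `DeepLayerLaws.RingRoomB 14 (BudgetClause σ_H 0) 3`
(`RuleD`/`Disj` = `LeggedFloor.RuleD`/`LeggedFloor.Disj`; ring clause `RingLe 3` = `Ring3`).  Letters ≠ sheaves ≠ SEED.

THE THEOREM (`thirteen_negE_le_eight_massP`, height-free).  For a design `D` on the alphabet of height `h` with `A1`, RULE D, `Disj`,
ring 3 and the three binders,
  `13 · (−E_h(D)) ≤ 8 · Σ_P m`.
Hence (`no_branchB_of_budget`) `Σ_P m ≤ 50 ∧ E ≤ −32 ⟹ False`: together with negation's balance law (S3) «B′ ⟹ q = −E∕8 ≥ 4 under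
(M1)(M2)» (POINT-SHADOW-negation-g22.md, pen) this is the conditional closure of Branch B′ of bus RESULT-5 ∕ RESULT-6 — with (M4) and the
AABH-tax step no longer load-bearing, exactly as booked in the dual CONFIRM of negation RESULT-6 §3.  What is NOT displayed-and-discharged
here: (S3) itself and (M2) «N has no hub-free cell» (they live on negation's side), and the ×2 of the three binders.

THE MECHANISM (one line each).
* CELL WEIGHT `W(c) := Σ_{12 placements} pm_{k;f,g}(c) + 2·Σ_{6 pairs} pw_{g,g'}(c) + 4·dep_h(c)` (`weight`).
* LOWER BOUND from the laws of `ShellThreePairLaw` §3–§3b (repeated verbatim in §1–§3b below, this module being self-contained while the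
  farm snapshot lacks the companion modules): mixed law `E = 2(Σ_N m·pm − Σ_P m·pm)` at each of the 12 placements, pair law
  `E = 4(Σ_N m·pw − Σ_P m·pw)` at each of the 6 pairs, `E = Σ_N m·dep − Σ_P m·dep`; all N-side terms are `≥ 0`; so
  `Σ_P m·W ≥ 12·(−E∕2) + 2·6·(−E∕4) + 4·(−E) = 13·(−E)`.
* UPPER BOUND `W(c) ≤ 8` for every supported P cell (`weight_le_eight`): the weight depends only on the KIND vector of the cell
  (kinds `H,u,A,B,C,D` = hub, unit, on∕off-axis co-level 2, on∕off-axis co-level 3; `weight_eq_KW`), the coarse door of `ShellThreeDoorB`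
  (repeated verbatim in §12 below) restricts the kind vectors of supported P cells to those satisfying (F1) hub-free ⟹ no off-axis kind,
  co-levels ≤ 2, at most one co-level 2 [the binders]; (F2) no «off-axis + co-level 3 + hub + all-charged» [`noP_off2_col3_hub`]; (F3) no
  «co-level 2 + two off-axis + hub» [`noP_col2_off2_off2_hub`] (`kinds_allowed`), and the kind-level inequality `KW ≤ 8` under (F1)–(F3)
  is a finite check over the `6⁴` kind vectors (`KW_le_eight`, `decide`).  Extremal kinds: `AADH` (one placement of mixed weight 8),
  `DDHH` (pair weight 4), `Auuu` (depth 2).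
* SUM: `13·(−E) ≤ Σ_P m·W ≤ 8·Σ_P m`.

PROVENANCE.  §1–§3b = `ShellThreePairLaw` v11 §1–§3b verbatim; §12 = `ShellThreeDoorB` §7-helpers + §12 (L0)–(L5) verbatim (same names, this
namespace; definitionally equal); §13 is new.  Farm `lean check`: rc 0, 0 sorries. -/

set_option linter.dupNamespace false
set_option autoImplicit false

namespace Summit.HodgeConjecture.HodgeConjecture.Cruxes.BlochSeedDiscOne.ShellThreeFloorB

open Summit.HodgeConjecture.HodgeConjecture.Cruxes.BlochSeedDiscOne.DepthBoundA4
open Summit.HodgeConjecture.HodgeConjecture.Cruxes.BlochSeedDiscOne.RingFourEmpty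
open Summit.HodgeConjecture.HodgeConjecture.Cruxes.BlochSeedDiscOne.RingTwoMassLaw
open Summit.HodgeConjecture.HodgeConjecture.Cruxes.BlochSeedDiscOne.RingTwoMassLaw.CI (A1e a1e_of_a1)
open Summit.HodgeConjecture.HodgeConjecture.Cruxes.BlochSeedDiscOne.RingTwoMassLaw.ClassLaw

/-! ## §1 The off-axis weight `q_h` -/

/-- `q_h(ℓ) = selfInt − 2h·a + h²` — the e-free per-slot functional `pt − 2h·h + h²·1`. -/
def qv (h : ℤ) (ℓ : Letter) : ℤ := ℓ.selfInt - 2 * h * ℓ.a + h ^ 2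

/-- on the height-`h` alphabet `q_h(ℓ) = 2|x||y|`. -/
theorem qv_eq {h : ℤ} {ℓ : Letter} (hℓ : ℓ.OnAlphabet h) : qv h ℓ = 2 * |ℓ.x| * |ℓ.y| := by
  obtain ⟨hh, _⟩ := hℓ
  unfold Letter.height at hh
  have hx : |ℓ.x| ^ 2 = ℓ.x ^ 2 := sq_abs _
  have hy : |ℓ.y| ^ 2 = ℓ.y ^ 2 := sq_abs _
  unfold qv Letter.selfInt Letter.bnorm
  have e : h = ℓ.a + |ℓ.x| + |ℓ.y| := hh.symm
  subst e
  linear_combination hx + hy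

theorem qv_nonneg {h : ℤ} {ℓ : Letter} (hℓ : ℓ.OnAlphabet h) : 0 ≤ qv h ℓ := by
  rw [qv_eq hℓ]; positivity

/-- the pair functional `σ_{g,g'} = q_h(c_g)·q_h(c_{g'})`. -/
def sig (h : ℤ) (g g' : Fin 4) (c : Cell) : ℤ := qv h (c g) * qv h (c g')

/-- the PAIR WEIGHT `|x_g y_g|·|x_{g'} y_{g'}|` (ring 3: `BB ↦ 1`, `BD ↦ 2`, `DD ↦ 4`; ring 2: `DD ↦ 1`; axis letters `↦ 0`). -/
def pw (g g' : Fin 4) (c : Cell) : ℤ := (|(c g).x| * |(c g).y|) * (|(c g').x| * |(c g').y|)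

theorem sig_eq_four_pw {h : ℤ} {c : Cell} (hc : ∀ f : Fin 4, (c f).OnAlphabet h) (g g' : Fin 4) :
    sig h g g' c = 4 * pw g g' c := by
  unfold sig pw
  rw [qv_eq (hc g), qv_eq (hc g')]
  ring

/-! ## §2 Word bookkeeping -/

/-- the word with `s` at slot `g`, `t` at slot `g'`, `1` elsewhere. -/
def wq (g g' : Fin 4) (s t : Sym) : Word := fun f => if f = g then s else if f = g' then t else Sym.one

theorem efree_wq (g g' : Fin 4) {s t : Sym} (hs : s.efree = true) (ht : t.efree = true) : (wq g g' s t).efree := by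
  intro f
  unfold wq
  split_ifs
  · exact hs
  · exact ht
  · rfl

theorem deg_wq {g g' : Fin 4} (hne : g ≠ g') (s t : Sym) : (wq g g' s t).deg = s.deg + t.deg := by
  fin_cases g <;> fin_cases g' <;> first
    | exact absurd rfl hne
    | (simp +decide [Word.deg, wq, Fin.sum_univ_four, Sym.deg]; try omega)

theorem icellCoef_wq {g g' : Fin 4} (hne : g ≠ g') (s t : Sym) (c : Cell) :
    icellCoef c (wq g g' s t) = s.icoef (c g) * t.icoef (c g') := by
  fin_cases g <;> fin_cases g' <;> first
    | exact absurd rfl hne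
    | (simp +decide [icellCoef, wq, Fin.prod_univ_four, Sym.icoef]; try ring)

/-- the four e-free words with one `h` (degree 1) and their reference word. -/
def wordsH1 : List Word :=
  [![Sym.h, Sym.one, Sym.one, Sym.one], ![Sym.one, Sym.h, Sym.one, Sym.one],
   ![Sym.one, Sym.one, Sym.h, Sym.one], ![Sym.one, Sym.one, Sym.one, Sym.h]]
/-- degree-1 reference word -/
def ref1 : Word := ![Sym.h, Sym.one, Sym.one, Sym.one]

set_option maxRecDepth 20000 in
theorem wordsH1_ok : ∀ w ∈ wordsH1, efreeB w = true ∧ Word.deg w = 1 := by decide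
theorem wordsH1_length : wordsH1.length = 4 := rfl

theorem SO_H1 (c : Cell) : SO wordsH1 c = (c 0).a + (c 1).a + (c 2).a + (c 3).a := by
  simp [SO, wordsH1, icellCoef, Fin.prod_univ_four, Sym.icoef]
  ring

theorem icellCoef_unit (c : Cell) : icellCoef c Word.unit = 1 := by
  simp [icellCoef, Word.unit, Sym.icoef]

theorem unit_efree : Word.unit.efree := fun _ => rfl

/-! ## §3 THE PAIR LAW -/

/-- binomial expansion of the depth functional into orbit sums. -/
theorem dep_expand (h : ℤ) (c : Cell) : dep h c =
    h ^ 4 * icellCoef c Word.unit - h ^ 3 * SO wordsH1 c + h ^ 2 * SO wordsHH c - h * SO wordsHHH c + SO wordsHHHH c := by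
  rw [SO_H1, SO_HH, SO_HHH, SO_HHHH, icellCoef_unit]
  simp only [dep, Fin.prod_univ_four, oHH, oHHH, oHHHH]
  ring

theorem linZ_dep (h : ℤ) (L : List (Cell × ℕ)) : linZ L (dep h) =
    h ^ 4 * linZ L (fun c => icellCoef c Word.unit) - h ^ 3 * linZ L (SO wordsH1) + h ^ 2 * linZ L (SO wordsHH)
      - h * linZ L (SO wordsHHH) + linZ L (SO wordsHHHH) := by
  induction L with
  | nil => simp [linZ]
  | cons a t ih => simp only [linZ_cons]; rw [ih, dep_expand]; ring

/-- `E = h⁴ t₀ − 4h³ t₁ + 6h² t₂ − 4h t₃ + t₄`. -/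
theorem E_expand (h : ℤ) (D : Design) (h1 : D.A1) : E h D =
    h ^ 4 * D.Tz Word.unit - 4 * h ^ 3 * D.Tz ref1 + 6 * h ^ 2 * D.Tz ref2 - 4 * h * D.Tz ref3 + D.Tz ref4 := by
  have r1 := orbit_row D h1 ref1 (by decide) 1 (by decide) wordsH1 wordsH1_ok
  have r2 := orbit_row D h1 ref2 (by decide) 2 (by decide) wordsHH wordsHH_ok
  have r3 := orbit_row D h1 ref3 (by decide) 3 (by decide) wordsHHH wordsHHH_ok
  have r4 := orbit_row D h1 ref4 (by decide) 4 (by decide) wordsHHHH wordsHHHH_ok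
  rw [wordsH1_length] at r1; rw [wordsHH_length] at r2; rw [wordsHHH_length] at r3; rw [wordsHHHH_length] at r4
  unfold E
  rw [linZ_dep, linZ_dep]
  unfold Design.Tz at *
  push_cast at *
  linear_combination (-h ^ 3) * r1 + h ^ 2 * r2 - h * r3 + r4

/-- expansion of the pair functional into nine two-slot words. -/
theorem sig_expand (h : ℤ) {g g' : Fin 4} (hne : g ≠ g') (c : Cell) : sig h g g' c =
    icellCoef c (wq g g' Sym.pt Sym.pt)
      - 2 * h * (icellCoef c (wq g g' Sym.pt Sym.h) + icellCoef c (wq g g' Sym.h Sym.pt))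
      + h ^ 2 * (icellCoef c (wq g g' Sym.pt Sym.one) + icellCoef c (wq g g' Sym.one Sym.pt))
      + 4 * h ^ 2 * icellCoef c (wq g g' Sym.h Sym.h)
      - 2 * h ^ 3 * (icellCoef c (wq g g' Sym.h Sym.one) + icellCoef c (wq g g' Sym.one Sym.h))
      + h ^ 4 * icellCoef c (wq g g' Sym.one Sym.one) := by
  simp only [icellCoef_wq hne, Sym.icoef, sig, qv]
  ring

theorem linZ_sig (h : ℤ) {g g' : Fin 4} (hne : g ≠ g') (L : List (Cell × ℕ)) : linZ L (sig h g g') =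
    linZ L (fun c => icellCoef c (wq g g' Sym.pt Sym.pt))
      - 2 * h * (linZ L (fun c => icellCoef c (wq g g' Sym.pt Sym.h)) + linZ L (fun c => icellCoef c (wq g g' Sym.h Sym.pt)))
      + h ^ 2 * (linZ L (fun c => icellCoef c (wq g g' Sym.pt Sym.one)) + linZ L (fun c => icellCoef c (wq g g' Sym.one Sym.pt)))
      + 4 * h ^ 2 * linZ L (fun c => icellCoef c (wq g g' Sym.h Sym.h))
      - 2 * h ^ 3 * (linZ L (fun c => icellCoef c (wq g g' Sym.h Sym.one)) + linZ L (fun c => icellCoef c (wq g g' Sym.one Sym.h)))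
      + h ^ 4 * linZ L (fun c => icellCoef c (wq g g' Sym.one Sym.one)) := by
  induction L with
  | nil => simp [linZ]
  | cons a t ih => simp only [linZ_cons]; rw [ih, sig_expand h hne]; ring

/-- **THE PAIR LAW** (every height, every ring; clause 2 of (A1) only): `E_h(D) = (Σ_N − Σ_P) m·q_h(c_g)·q_h(c_{g'})` for any two
slots `g ≠ g'`. -/
theorem pair_law (h : ℤ) (D : Design) (h1 : D.A1) {g g' : Fin 4} (hne : g ≠ g') :
    E h D = linZ D.N (sig h g g') - linZ D.P (sig h g g') := by
  have dq : ∀ s t : Sym, s.efree = true → t.efree = true → ∀ r : Word, r.efree → r.deg = s.deg + t.deg →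
      D.Tz (wq g g' s t) = D.Tz r := fun s t hs ht r hr hd =>
    Tz_eq_of_A1 D h1 _ _ (efree_wq g g' hs ht) hr (by rw [deg_wq hne, hd])
  have q1 := dq Sym.pt Sym.pt rfl rfl ref4 (efree_of_efreeB _ (by decide)) (by decide)
  have q2 := dq Sym.pt Sym.h rfl rfl ref3 (efree_of_efreeB _ (by decide)) (by decide)
  have q3 := dq Sym.h Sym.pt rfl rfl ref3 (efree_of_efreeB _ (by decide)) (by decide)
  have q4 := dq Sym.pt Sym.one rfl rfl ref2 (efree_of_efreeB _ (by decide)) (by decide)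
  have q5 := dq Sym.one Sym.pt rfl rfl ref2 (efree_of_efreeB _ (by decide)) (by decide)
  have q6 := dq Sym.h Sym.h rfl rfl ref2 (efree_of_efreeB _ (by decide)) (by decide)
  have q7 := dq Sym.h Sym.one rfl rfl ref1 (efree_of_efreeB _ (by decide)) (by decide)
  have q8 := dq Sym.one Sym.h rfl rfl ref1 (efree_of_efreeB _ (by decide)) (by decide)
  have q9 := dq Sym.one Sym.one rfl rfl Word.unit unit_efree (by decide)
  rw [E_expand h D h1, linZ_sig h hne, linZ_sig h hne]
  unfold Design.Tz at *
  linear_combination (-1 : ℤ) * q1 + 2 * h * (q2 + q3) - h ^ 2 * (q4 + q5) - 4 * h ^ 2 * q6 + 2 * h ^ 3 * (q7 + q8) - h ^ 4 * q9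

/-! ## §3b THE MIXED LAW — the third (and last) degree-4 shape `(2,1,1,0)`

Under clause 2 a per-slot e-free factor of degree `d ∈ {0,1,2}` (`1`, `h − a`, `q_h`) stands for `(h − z)^d`; the degree-4
products are exactly the three shapes `(1,1,1,1)` = `dep`, `(2,2,0,0)` = `sig` and `(2,1,1,0)` = `mid` below, and all three have
the same signed moment `E`.  On the alphabet `mid = 2·|x_k y_k|·col_f·col_g ≥ 0` termwise. -/

theorem icoef_one (ℓ : Letter) : Sym.one.icoef ℓ = 1 := rfl

/-- the word with `s` at slot `k`, `t` at slot `f`, `r` at slot `g`, `1` elsewhere. -/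
def wt (k f g : Fin 4) (s t r : Sym) : Word :=
  fun i => if i = k then s else if i = f then t else if i = g then r else Sym.one

theorem efree_wt (k f g : Fin 4) {s t r : Sym} (hs : s.efree = true) (ht : t.efree = true) (hr : r.efree = true) :
    (wt k f g s t r).efree := by
  intro i
  unfold wt
  split_ifs
  · exact hs
  · exact ht
  · exact hr
  · rfl

theorem deg_wt {k f g : Fin 4} (hkf : k ≠ f) (hkg : k ≠ g) (hfg : f ≠ g) (s t r : Sym) :
    (wt k f g s t r).deg = s.deg + t.deg + r.deg := by
  fin_cases k <;> fin_cases f <;> fin_cases g <;> first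
    | exact absurd rfl hkf
    | exact absurd rfl hkg
    | exact absurd rfl hfg
    | (simp +decide [Word.deg, wt, Fin.sum_univ_four, Sym.deg]; try omega)

theorem icellCoef_wt {k f g : Fin 4} (hkf : k ≠ f) (hkg : k ≠ g) (hfg : f ≠ g) (s t r : Sym) (c : Cell) :
    icellCoef c (wt k f g s t r) = s.icoef (c k) * t.icoef (c f) * r.icoef (c g) := by
  fin_cases k <;> fin_cases f <;> fin_cases g <;> first
    | exact absurd rfl hkf
    | exact absurd rfl hkg
    | exact absurd rfl hfg
    | (simp +decide [icellCoef, wt, Fin.prod_univ_four, icoef_one, -mul_eq_mul_left_iff, -mul_eq_mul_right_iff]; try ring)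

/-- the mixed functional `q_h(c_k)·(h − a_f)·(h − a_g)`. -/
def mid (h : ℤ) (k f g : Fin 4) (c : Cell) : ℤ := qv h (c k) * ((h - (c f).a) * (h - (c g).a))

/-- the MIXED WEIGHT `|x_k y_k|·col_f·col_g`. -/
def pm (k f g : Fin 4) (c : Cell) : ℤ := (|(c k).x| * |(c k).y|) * ((c f).colevel * (c g).colevel)

theorem col_eq {h : ℤ} {ℓ : Letter} (hℓ : ℓ.OnAlphabet h) : h - ℓ.a = ℓ.colevel := by
  obtain ⟨hh, _⟩ := hℓ
  unfold Letter.height at hh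
  unfold Letter.colevel
  omega

theorem mid_eq_two_pm {h : ℤ} {c : Cell} (hc : ∀ f : Fin 4, (c f).OnAlphabet h) (k f g : Fin 4) :
    mid h k f g c = 2 * pm k f g c := by
  unfold mid pm
  rw [qv_eq (hc k), col_eq (hc f), col_eq (hc g)]
  ring

theorem pm_nonneg (k f g : Fin 4) (c : Cell) : 0 ≤ pm k f g c := by
  unfold pm Letter.colevel; positivity

theorem mid_expand (h : ℤ) {k f g : Fin 4} (hkf : k ≠ f) (hkg : k ≠ g) (hfg : f ≠ g) (c : Cell) : mid h k f g c =
    icellCoef c (wt k f g Sym.pt Sym.h Sym.h)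
      - h * (icellCoef c (wt k f g Sym.pt Sym.h Sym.one) + icellCoef c (wt k f g Sym.pt Sym.one Sym.h))
      + h ^ 2 * icellCoef c (wt k f g Sym.pt Sym.one Sym.one)
      - 2 * h * icellCoef c (wt k f g Sym.h Sym.h Sym.h)
      + 2 * h ^ 2 * (icellCoef c (wt k f g Sym.h Sym.h Sym.one) + icellCoef c (wt k f g Sym.h Sym.one Sym.h))
      - 2 * h ^ 3 * icellCoef c (wt k f g Sym.h Sym.one Sym.one)
      + h ^ 2 * icellCoef c (wt k f g Sym.one Sym.h Sym.h)
      - h ^ 3 * (icellCoef c (wt k f g Sym.one Sym.h Sym.one) + icellCoef c (wt k f g Sym.one Sym.one Sym.h))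
      + h ^ 4 * icellCoef c (wt k f g Sym.one Sym.one Sym.one) := by
  simp only [icellCoef_wt hkf hkg hfg, Sym.icoef, mid, qv]
  ring

theorem linZ_mid (h : ℤ) {k f g : Fin 4} (hkf : k ≠ f) (hkg : k ≠ g) (hfg : f ≠ g) (L : List (Cell × ℕ)) :
    linZ L (mid h k f g) =
    linZ L (fun c => icellCoef c (wt k f g Sym.pt Sym.h Sym.h))
      - h * (linZ L (fun c => icellCoef c (wt k f g Sym.pt Sym.h Sym.one))
              + linZ L (fun c => icellCoef c (wt k f g Sym.pt Sym.one Sym.h)))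
      + h ^ 2 * linZ L (fun c => icellCoef c (wt k f g Sym.pt Sym.one Sym.one))
      - 2 * h * linZ L (fun c => icellCoef c (wt k f g Sym.h Sym.h Sym.h))
      + 2 * h ^ 2 * (linZ L (fun c => icellCoef c (wt k f g Sym.h Sym.h Sym.one))
              + linZ L (fun c => icellCoef c (wt k f g Sym.h Sym.one Sym.h)))
      - 2 * h ^ 3 * linZ L (fun c => icellCoef c (wt k f g Sym.h Sym.one Sym.one))
      + h ^ 2 * linZ L (fun c => icellCoef c (wt k f g Sym.one Sym.h Sym.h))
      - h ^ 3 * (linZ L (fun c => icellCoef c (wt k f g Sym.one Sym.h Sym.one))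
              + linZ L (fun c => icellCoef c (wt k f g Sym.one Sym.one Sym.h)))
      + h ^ 4 * linZ L (fun c => icellCoef c (wt k f g Sym.one Sym.one Sym.one)) := by
  induction L with
  | nil => simp [linZ]
  | cons a t ih => simp only [linZ_cons]; rw [ih, mid_expand h hkf hkg hfg]; ring

/-- **THE MIXED LAW** (every height, every ring; clause 2 only): `E_h(D) = (Σ_N − Σ_P) m·q_h(c_k)·(h − a_f)(h − a_g)` for any
three distinct slots. -/
theorem mid_law (h : ℤ) (D : Design) (h1 : D.A1) {k f g : Fin 4} (hkf : k ≠ f) (hkg : k ≠ g) (hfg : f ≠ g) :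
    E h D = linZ D.N (mid h k f g) - linZ D.P (mid h k f g) := by
  have dq : ∀ s t r : Sym, s.efree = true → t.efree = true → r.efree = true → ∀ w : Word, w.efree →
      w.deg = s.deg + t.deg + r.deg → D.Tz (wt k f g s t r) = D.Tz w := fun s t r hs ht hr w hw hd =>
    Tz_eq_of_A1 D h1 _ _ (efree_wt k f g hs ht hr) hw (by rw [deg_wt hkf hkg hfg, hd])
  have q1 := dq Sym.pt Sym.h Sym.h rfl rfl rfl ref4 (efree_of_efreeB _ (by decide)) (by decide)
  have q2 := dq Sym.pt Sym.h Sym.one rfl rfl rfl ref3 (efree_of_efreeB _ (by decide)) (by decide)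
  have q3 := dq Sym.pt Sym.one Sym.h rfl rfl rfl ref3 (efree_of_efreeB _ (by decide)) (by decide)
  have q4 := dq Sym.pt Sym.one Sym.one rfl rfl rfl ref2 (efree_of_efreeB _ (by decide)) (by decide)
  have q5 := dq Sym.h Sym.h Sym.h rfl rfl rfl ref3 (efree_of_efreeB _ (by decide)) (by decide)
  have q6 := dq Sym.h Sym.h Sym.one rfl rfl rfl ref2 (efree_of_efreeB _ (by decide)) (by decide)
  have q7 := dq Sym.h Sym.one Sym.h rfl rfl rfl ref2 (efree_of_efreeB _ (by decide)) (by decide)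
  have q8 := dq Sym.h Sym.one Sym.one rfl rfl rfl ref1 (efree_of_efreeB _ (by decide)) (by decide)
  have q9 := dq Sym.one Sym.h Sym.h rfl rfl rfl ref2 (efree_of_efreeB _ (by decide)) (by decide)
  have q10 := dq Sym.one Sym.h Sym.one rfl rfl rfl ref1 (efree_of_efreeB _ (by decide)) (by decide)
  have q11 := dq Sym.one Sym.one Sym.h rfl rfl rfl ref1 (efree_of_efreeB _ (by decide)) (by decide)
  have q12 := dq Sym.one Sym.one Sym.one rfl rfl rfl Word.unit unit_efree (by decide)
  rw [E_expand h D h1, linZ_mid h hkf hkg hfg, linZ_mid h hkf hkg hfg]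
  unfold Design.Tz at *
  linear_combination (-1 : ℤ) * q1 + h * (q2 + q3) - h ^ 2 * q4 + 2 * h * q5 - 2 * h ^ 2 * (q6 + q7)
    + 2 * h ^ 3 * q8 - h ^ 2 * q9 + h ^ 3 * (q10 + q11) - h ^ 4 * q12

theorem onAlphabet_of_N {h : ℤ} {D : Design} (hD : D.OnAlphabet h) {cm : Cell × ℕ} (hcm : cm ∈ D.N) (hpos : 0 < cm.2)
    (f : Fin 4) : (cm.1 f).OnAlphabet h :=
  hD cm.1 (List.mem_append.mpr (Or.inl ((mem_suppN_iff D cm.1).mpr ⟨cm.2, by simpa using hcm, hpos⟩))) f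

theorem onAlphabet_of_P {h : ℤ} {D : Design} (hD : D.OnAlphabet h) {cm : Cell × ℕ} (hcm : cm ∈ D.P) (hpos : 0 < cm.2)
    (f : Fin 4) : (cm.1 f).OnAlphabet h :=
  hD cm.1 (List.mem_append.mpr (Or.inr ((mem_suppP_iff D cm.1).mpr ⟨cm.2, by simpa using hcm, hpos⟩))) f

/-- **THE PAIR LAW on the alphabet**: `E = 4·(k^N(g,g') − k^P(g,g'))`, `k^X(g,g') = Σ_X m·|x_g y_g|·|x_{g'} y_{g'}|`. -/
theorem pair_law_alphabet {h : ℤ} {D : Design} (hD : D.OnAlphabet h) (h1 : D.A1) {g g' : Fin 4} (hne : g ≠ g') :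
    E h D = 4 * (linZ D.N (pw g g') - linZ D.P (pw g g')) := by
  rw [pair_law h D h1 hne]
  rw [linZ_congr' D.N (sig h g g') (fun c => 4 * pw g g' c) fun cm hm hp => sig_eq_four_pw (onAlphabet_of_N hD hm hp) g g',
    linZ_congr' D.P (sig h g g') (fun c => 4 * pw g g' c) fun cm hm hp => sig_eq_four_pw (onAlphabet_of_P hD hm hp) g g',
    linZ_smul, linZ_smul]
  ring

/-- the MIXED LAW on the alphabet: `E = 2·(τ^N − τ^P)(k;f,g)` with `τ^X = Σ_X m·|x_k y_k|·col_f·col_g`. -/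
theorem mid_law_alphabet {h : ℤ} {D : Design} (hD : D.OnAlphabet h) (h1 : D.A1) {k f g : Fin 4} (hkf : k ≠ f)
    (hkg : k ≠ g) (hfg : f ≠ g) : E h D = 2 * (linZ D.N (pm k f g) - linZ D.P (pm k f g)) := by
  rw [mid_law h D h1 hkf hkg hfg]
  rw [linZ_congr' D.N (mid h k f g) (fun c => 2 * pm k f g c) fun cm hm hp => mid_eq_two_pm (onAlphabet_of_N hD hm hp) k f g,
    linZ_congr' D.P (mid h k f g) (fun c => 2 * pm k f g c) fun cm hm hp => mid_eq_two_pm (onAlphabet_of_P hD hm hp) k f g,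
    linZ_smul, linZ_smul]
  ring

/-- in particular `E ≤ −8` forces `τ^P(k;f,g) ≥ τ^N(k;f,g) + 4` for every slot `k` and every pair `{f,g}` of other slots:
the P side carries an off-axis letter at EVERY slot `k` inside cells that are hub-free at `f` and `g`. -/
theorem mixedMassP_ge_of_E_le {h : ℤ} {D : Design} (hD : D.OnAlphabet h) (h1 : D.A1) (hE : E h D ≤ -8) {k f g : Fin 4}
    (hkf : k ≠ f) (hkg : k ≠ g) (hfg : f ≠ g) : linZ D.N (pm k f g) + 4 ≤ linZ D.P (pm k f g) := by
  have := mid_law_alphabet hD h1 hkf hkg hfg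
  omega

theorem mixedMassN_ge_of_le_E {h : ℤ} {D : Design} (hD : D.OnAlphabet h) (h1 : D.A1) (hE : 8 ≤ E h D) {k f g : Fin 4}
    (hkf : k ≠ f) (hkg : k ≠ g) (hfg : f ≠ g) : linZ D.P (pm k f g) + 4 ≤ linZ D.N (pm k f g) := by
  have := mid_law_alphabet hD h1 hkf hkg hfg
  omega

/-- parity of the pair masses: `k^N(g,g') ≡ k^P(g,g') (mod 2)` (from `8 ∣ E`). -/
theorem two_dvd_pairMass_sub {h : ℤ} {D : Design} (hD : D.OnAlphabet h) (h1 : D.A1) {g g' : Fin 4} (hne : g ≠ g') :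
    (2 : ℤ) ∣ linZ D.N (pw g g') - linZ D.P (pw g g') := by
  have h8 := (lattice_digits hD (a1e_of_a1 D h1)).1
  rw [pair_law_alphabet hD h1 hne] at h8
  omega

/-- the pair masses are the SAME at all six slot pairs. -/
theorem pairMass_sub_indep {h : ℤ} {D : Design} (hD : D.OnAlphabet h) (h1 : D.A1) {g g' k k' : Fin 4} (hne : g ≠ g')
    (hne' : k ≠ k') : linZ D.N (pw g g') - linZ D.P (pw g g') = linZ D.N (pw k k') - linZ D.P (pw k k') := by
  have a := pair_law_alphabet hD h1 hne
  have b := pair_law_alphabet hD h1 hne'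
  omega

theorem pw_nonneg (g g' : Fin 4) (c : Cell) : 0 ≤ pw g g' c := by unfold pw; positivity

/-- `E ≤ −8` ⟹ `k^P(g,g') ≥ k^N(g,g') + 2 ≥ 2` at every slot pair: the P side carries off-axis pairs everywhere. -/
theorem pairMassP_ge_of_E_le {h : ℤ} {D : Design} (hD : D.OnAlphabet h) (h1 : D.A1) (hE : E h D ≤ -8) {g g' : Fin 4}
    (hne : g ≠ g') : linZ D.N (pw g g') + 2 ≤ linZ D.P (pw g g') := by
  have a := pair_law_alphabet hD h1 hne
  omega

/-- `8 ≤ E` ⟹ `k^N(g,g') ≥ k^P(g,g') + 2 ≥ 2` at every slot pair. -/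
theorem pairMassN_ge_of_le_E {h : ℤ} {D : Design} (hD : D.OnAlphabet h) (h1 : D.A1) (hE : 8 ≤ E h D) {g g' : Fin 4}
    (hne : g ≠ g') : linZ D.P (pw g g') + 2 ≤ linZ D.N (pw g g') := by
  have a := pair_law_alphabet hD h1 hne
  omega


/-! ## §11c-excerpt (verbatim from `ShellThreePairLaw` v11): the depth product on the alphabet -/

theorem dep_eq_prod_colevel {h : ℤ} {c : Cell} (hc : ∀ f : Fin 4, (c f).OnAlphabet h) :
    dep h c = ∏ f : Fin 4, (c f).colevel := by
  unfold dep
  exact Finset.prod_congr rfl fun f _ => col_eq (hc f)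

theorem dep_nonneg_alphabet {h : ℤ} {c : Cell} (hc : ∀ f : Fin 4, (c f).OnAlphabet h) : 0 ≤ dep h c := by
  rw [dep_eq_prod_colevel hc]
  exact Finset.prod_nonneg fun f _ => by unfold Letter.colevel; positivity


/-! ## §12 (verbatim from `ShellThreeDoorB` @72eed19ae9d6): §7-helpers and the coarse door (L0)–(L5) -/

/-- an off-axis letter: both coordinates non-zero (types `B`, `D` at shell 3). -/
def OffAxis (ℓ : Letter) : Prop := ℓ.x ≠ 0 ∧ ℓ.y ≠ 0


theorem two_le_colevel_of_offAxis (ℓ : Letter) (hoff : OffAxis ℓ) : 2 ≤ ℓ.colevel := by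
  have hP : 0 < |ℓ.x| := abs_pos.mpr hoff.1
  have hQ : 0 < |ℓ.y| := abs_pos.mpr hoff.2
  unfold Letter.colevel
  omega



/-! ## §12 PROPAGATION OF gs-eng-2 (B) UNDER THE COARSE DOOR (RULE D + `Disj` + alphabet + ring 3; height-free)

(B) = «at shell 3 every HUB-FREE supported P cell has type u⁴, Auuu, AAuu, AAAu, AAAA or Buuu» (gs-eng-2 RESULT-4 (B), a CAPSAT
fact of their fine room; here a DISPLAYED BINDER `HubfreePB D`, NOT proved).  Everything below is pen-sized RULE-D chasing at ONE
block «{charged slot, hub slot}» (hub-leg blocks): a supplier ∕ consumer equals the cell off the block and moves a block letter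
strictly (`Disj` forbids equality), and on the alphabet (i) nothing lies above a hub letter (`not_nullStep_of_col_zero`), (ii) an
OFF-AXIS letter never null-steps to a hub letter — `x² + y² = (|x| + |y|)²` forces `x·y = 0` (`not_nullStep_hub_of_offAxis`),
(iii) in ring 3 nothing lies below a co-level-3 letter.  Consequences (supported cells, `D.OnAlphabet h`, `Disj`, `RuleD`,
`Ring3` = `DeepLayerLaws.RingLe 3`, (B)):
* `hubfreeN_onAxis`        — NO hub-free N cell has an off-axis letter (N Buuu, BBuu, ABuu, … : gs-eng-2 (A) is a COROLLARY of (B));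
* `noN_col3_oneHub`        — no N cell «hub + co-level-3 letter + all other letters charged» (N CHuu, DHuu, ADHu-type, …);
* `noP_off2_col3_hub`      — no P cell «off-axis + col-3 + hub + charged» (P BDHu, BCHu, DDHu, CDHu, BBDH-type, …);
* `noN_col2_off2_hub`      — no N cell «col-2 + off-axis + hub + charged» (N ABHu, BBHu, BBBH, AABH/ABDH-type, …);
* `noN_col3_off2_HH`       — no N cell «col-3 + off-axis + hub + hub» (N BDHH, BCHH, DDHH, CDHH);
* `noP_col2_off2_off2_hub` — no P cell «col-2 + off-axis + off-axis + hub» (P ABBH, BBBH, ABDH, …)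
(an N «BBBH» is already a case of `noN_col2_off2_hub`).
Hence the support hypotheses of §11 are DISCHARGED by (B): `N_a2111_zero_B`, `N_a2210_zero_B`, `N_a2211_zero_B`,
`N_a2220_zero_B`, `P_a2211_zero_B`; and the §11 laws hold given (B): `hook_law_B` — `2·Σ_P m a2111∘σ′ = 4·Σ_P m a2210∘σ` for
ALL placements σ, σ′ (the P `Buuu` mass read at any slot is twice the P off-axis-pair/col mass of any class; at shell 3 the only
surviving P `a2210`-carriers are the `BBHu` cells) — and `offaxis_triple_free_B` (no P off-axis triple).  With §11c: at `E = −8`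
the forced hub-free N cell is ON-AXIS at every slot (`hubfreeN_onAxis_of_E_eq`).
Independent cross-check (not used here): the same emptiness list is the uncapped fixed point of support-level dead propagation on
gs-eng-2's fine room from seed (B) under the coarse door (scripts `deadprop_coarse.py` ∕ `deadwhy_coarse_out.txt`, HOME g16/work). -/

section PropagationB
open Summit.HodgeConjecture.HodgeConjecture.Cruxes.BlochSeedDiscOne.LeggedFloor

/-- ring 3 of the register: every supported letter has co-level `≤ 3` (verbatim the body of `DeepLayerLaws.RingLe 3 D`). -/
def Ring3 (D : Design) : Prop := ∀ x ∈ D.suppN ++ D.suppP, ∀ f : Fin 4, (x f).colevel ≤ 3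

/-- gs-eng-2 (B) as a displayed binder: a HUB-FREE supported P cell has no letter of co-level `≥ 3`, and an off-axis letter in it
forces every other letter to have co-level `≤ 1` (types u⁴, Auuu, AAuu, AAAu, AAAA, Buuu). -/
def HubfreePB (D : Design) : Prop :=
  ∀ x ∈ D.suppP, (∀ f : Fin 4, (x f).colevel ≠ 0) →
    (∀ f : Fin 4, (x f).colevel ≤ 2) ∧ (∀ k g : Fin 4, k ≠ g → OffAxis (x k) → (x g).colevel ≤ 1)

theorem col_nonneg (ℓ : Letter) : 0 ≤ ℓ.colevel := by unfold Letter.colevel; positivity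

theorem col_eq_of_onAlphabet {h : ℤ} {ℓ : Letter} (hℓ : ℓ.OnAlphabet h) : ℓ.colevel = h - ℓ.a := (col_eq hℓ).symm

theorem col_lt_of_nullStep {h : ℤ} {ℓ ℓ' : Letter} (hℓ : ℓ.OnAlphabet h) (hℓ' : ℓ'.OnAlphabet h) (hn : NullStep ℓ ℓ') :
    ℓ'.colevel < ℓ.colevel := by
  rw [col_eq_of_onAlphabet hℓ, col_eq_of_onAlphabet hℓ']
  have := hn.1
  omega

theorem col_le_of_eq_or_null {h : ℤ} {ℓ ℓ' : Letter} (hℓ : ℓ.OnAlphabet h) (hℓ' : ℓ'.OnAlphabet h)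
    (hs : ℓ = ℓ' ∨ NullStep ℓ ℓ') : ℓ'.colevel ≤ ℓ.colevel := by
  rcases hs with hs | hs
  · rw [hs]
  · exact (col_lt_of_nullStep hℓ hℓ' hs).le

/-- nothing on the alphabet lies above a hub letter (co-level `0`). -/
theorem not_nullStep_of_col_zero {h : ℤ} {ℓ ℓ' : Letter} (hℓ : ℓ.OnAlphabet h) (hℓ' : ℓ'.OnAlphabet h)
    (h0 : ℓ.colevel = 0) : ¬ NullStep ℓ ℓ' := by
  intro hn
  have := col_lt_of_nullStep hℓ hℓ' hn
  have := col_nonneg ℓ'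
  omega

theorem xy_zero_of_col_zero {ℓ : Letter} (h0 : ℓ.colevel = 0) : ℓ.x = 0 ∧ ℓ.y = 0 := by
  unfold Letter.colevel at h0
  have := abs_nonneg ℓ.x
  have := abs_nonneg ℓ.y
  exact ⟨abs_eq_zero.mp (by linarith), abs_eq_zero.mp (by linarith)⟩

/-- an OFF-AXIS letter never null-steps to a hub letter: `x² + y² = (|x| + |y|)²` forces `|x|·|y| = 0`. -/
theorem not_nullStep_hub_of_offAxis {h : ℤ} {ℓ ℓ' : Letter} (hℓ : ℓ.OnAlphabet h) (hℓ' : ℓ'.OnAlphabet h)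
    (hoff : OffAxis ℓ) (h0 : ℓ'.colevel = 0) : ¬ NullStep ℓ ℓ' := by
  intro hn
  have hx' := xy_zero_of_col_zero h0
  have e1 := hℓ.1
  have e2 := hℓ'.1
  unfold Letter.height at e1 e2
  obtain ⟨_, heq⟩ := hn
  rw [hx'.1, hx'.2] at heq e2
  simp only [abs_zero, add_zero] at e2
  have hd : ℓ'.a - ℓ.a = |ℓ.x| + |ℓ.y| := by omega
  rw [hd] at heq
  have hsx := sq_abs ℓ.x
  have hsy := sq_abs ℓ.y
  have hprod : 2 * (|ℓ.x| * |ℓ.y|) = 0 := by linear_combination (-1 : ℤ) * heq - hsx - hsy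
  rcases mul_eq_zero.mp hprod with h2 | h2
  · omega
  rcases mul_eq_zero.mp h2 with h1 | h1
  · exact hoff.1 (abs_eq_zero.mp h1)
  · exact hoff.2 (abs_eq_zero.mp h1)

theorem detects_of_col_ne_zero (c : Cell) (g j : Fin 4) (hg : (c g).colevel ≠ 0) : Detects c g j := by
  intro hd
  apply hg
  unfold Letter.colevel
  rw [hd.1, hd.2.1]
  simp

theorem detects_symm {c : Cell} {g j : Fin 4} (hd : Detects c g j) : Detects c j g := by
  intro h'
  exact hd ⟨h'.2.2.1, h'.2.2.2.1, h'.1, h'.2.1, h'.2.2.2.2.symm⟩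

theorem supplies_symm {x y : Cell} {g j : Fin 4} (hs : Supplies x y g j) : Supplies x y j g :=
  ⟨fun f hfj hfg => hs.1 f hfg hfj, hs.2.2, hs.2.1⟩

/-- RULE D (N side) at an unordered block. -/
theorem ruleDN_any {D : Design} (hr : RuleD D) {y : Cell} (hy : y ∈ D.suppN) {g j : Fin 4} (hne : g ≠ j)
    (hd : Detects y g j) : ∃ x ∈ D.suppP, Supplies x y g j := by
  rcases lt_or_gt_of_ne hne with hlt | hlt
  · exact hr.1 y hy g j hlt hd
  · obtain ⟨x, hx, hs⟩ := hr.1 y hy j g hlt (detects_symm hd)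
    exact ⟨x, hx, supplies_symm hs⟩

/-- RULE D (P side) at an unordered block. -/
theorem ruleDP_any {D : Design} (hr : RuleD D) {x : Cell} (hx : x ∈ D.suppP) {g j : Fin 4} (hne : g ≠ j)
    (hd : Detects x g j) : ∃ y ∈ D.suppN, Supplies x y g j := by
  rcases lt_or_gt_of_ne hne with hlt | hlt
  · exact hr.2 x hx g j hlt hd
  · obtain ⟨y, hy, hs⟩ := hr.2 x hx j g hlt (detects_symm hd)
    exact ⟨y, hy, supplies_symm hs⟩

/-- a supplier pair that agrees on both block slots is one cell. -/
theorem cell_eq_of_supplies {x y : Cell} {g j : Fin 4} (hs : Supplies x y g j) (hg : x g = y g) (hj : x j = y j) :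
    x = y := by
  funext f
  by_cases hfg : f = g
  · rw [hfg]; exact hg
  by_cases hfj : f = j
  · rw [hfj]; exact hj
  exact hs.1 f hfg hfj

/-- five slots in `Fin 4` cannot be pairwise distinct. -/
theorem fin4_exhaust (k l j g f : Fin 4) (hkl : k ≠ l) (hkj : k ≠ j) (hkg : k ≠ g) (hlj : l ≠ j) (hlg : l ≠ g)
    (hjg : j ≠ g) (hfk : f ≠ k) (hfl : f ≠ l) (hfj : f ≠ j) (hfg : f ≠ g) : False := by
  omega

/-- every slot is `σ i` for some `i`. -/
theorem forall_slot_of_perm (σ : Equiv.Perm (Fin 4)) {P : Fin 4 → Prop}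
    (h0 : P (σ 0)) (h1 : P (σ 1)) (h2 : P (σ 2)) (h3 : P (σ 3)) : ∀ f : Fin 4, P f := by
  intro f
  have key : ∀ i : Fin 4, P (σ i) := by
    intro i
    fin_cases i
    · exact h0
    · exact h1
    · exact h2
    · exact h3
  simpa using key (σ.symm f)

theorem offAxis_of_absmul_ne_zero {ℓ : Letter} (h : |ℓ.x| * |ℓ.y| ≠ 0) : OffAxis ℓ := by
  obtain ⟨hx, hy⟩ := mul_ne_zero_iff.mp h
  exact ⟨abs_ne_zero.mp hx, abs_ne_zero.mp hy⟩

/-- **(L0) under (B), no hub-free supported N cell has an off-axis letter** (coarse RULE D at the block `{k, j}`, any `j ≠ k`: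
the supplier is hub-free, hence allowed, hence equal to the N cell — `Disj`).  gs-eng-2 (A) «N charged ⊆ {u⁴, Auuu}» ⊇ this. -/
theorem hubfreeN_onAxis {h : ℤ} {D : Design} (hD : D.OnAlphabet h) (hr : RuleD D) (hdis : Disj D) (hB : HubfreePB D)
    {y : Cell} (hy : y ∈ D.suppN) (hfree : ∀ f : Fin 4, (y f).colevel ≠ 0) (k : Fin 4) : ¬ OffAxis (y k) := by
  intro hoff
  have hyA : ∀ f : Fin 4, (y f).OnAlphabet h := hD y (LeggedFloor.mem_supp_of_memN D hy)
  obtain ⟨j, hjk⟩ : ∃ j : Fin 4, j ≠ k := by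
    by_cases hk : k = 0
    · exact ⟨1, by rw [hk]; decide⟩
    · exact ⟨0, fun h0 => hk h0.symm⟩
  obtain ⟨x, hx, hs⟩ := ruleDN_any hr hy hjk.symm (detects_of_col_ne_zero y k j (hfree k))
  have hxA : ∀ f : Fin 4, (x f).OnAlphabet h := hD x (LeggedFloor.mem_supp_of_memP D hx)
  have hxfree : ∀ f : Fin 4, (x f).colevel ≠ 0 := by
    intro f
    by_cases hfk : f = k
    · rw [hfk]
      have h1 := col_le_of_eq_or_null (hxA k) (hyA k) hs.2.1
      have h2 := hfree k
      have h3 := col_nonneg (y k)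
      omega
    by_cases hfj : f = j
    · rw [hfj]
      have h1 := col_le_of_eq_or_null (hxA j) (hyA j) hs.2.2
      have h2 := hfree j
      have h3 := col_nonneg (y j)
      omega
    · rw [hs.1 f hfk hfj]; exact hfree f
  obtain ⟨hle2, hoffB⟩ := hB x hx hxfree
  have hxk : x k = y k := by
    rcases hs.2.1 with he | hn
    · exact he
    · exfalso
      have h1 := col_lt_of_nullStep (hxA k) (hyA k) hn
      have h2 := two_le_colevel_of_offAxis (y k) hoff
      have h3 := hle2 k
      omega
  have hxoff : OffAxis (x k) := by rw [hxk]; exact hoff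
  have hxj : x j = y j := by
    rcases hs.2.2 with he | hn
    · exact he
    · exfalso
      have h1 := col_lt_of_nullStep (hxA j) (hyA j) hn
      have h2 := hoffB k j hjk.symm hxoff
      have h3 := hfree j
      have h4 := col_nonneg (y j)
      omega
  have heq := cell_eq_of_supplies hs hxk hxj
  exact hdis x (by rw [heq]; exact hy) hx

/-- **(L1)** no supported N cell with a hub at `j`, a co-level-3 letter at `k`, and every letter off `j` charged
(block `{k, j}`: the supplier keeps the co-level-3 letter (ring 3), moves the hub (Disj), is hub-free with a col-3 letter: ¬(B)). -/
theorem noN_col3_oneHub {h : ℤ} {D : Design} (hD : D.OnAlphabet h) (hr : RuleD D) (hdis : Disj D) (h3 : Ring3 D)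
    (hB : HubfreePB D) {y : Cell} (hy : y ∈ D.suppN) {k j : Fin 4} (hkj : k ≠ j) (hk : (y k).colevel = 3)
    (hj : (y j).colevel = 0) (hch : ∀ f : Fin 4, f ≠ j → (y f).colevel ≠ 0) : False := by
  have hyA : ∀ f : Fin 4, (y f).OnAlphabet h := hD y (LeggedFloor.mem_supp_of_memN D hy)
  obtain ⟨x, hx, hs⟩ := ruleDN_any hr hy hkj (detects_of_col_ne_zero y k j (by rw [hk]; norm_num))
  have hxA : ∀ f : Fin 4, (x f).OnAlphabet h := hD x (LeggedFloor.mem_supp_of_memP D hx)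
  have hxk : x k = y k := by
    rcases hs.2.1 with he | hn
    · exact he
    · exfalso
      have h1 := col_lt_of_nullStep (hxA k) (hyA k) hn
      have h2 := h3 x (LeggedFloor.mem_supp_of_memP D hx) k
      omega
  have hnj : NullStep (x j) (y j) := by
    rcases hs.2.2 with he | hn
    · exact (hdis x (by rw [cell_eq_of_supplies hs hxk he]; exact hy) hx).elim
    · exact hn
  have hxj : (x j).colevel ≠ 0 := by
    have h1 := col_lt_of_nullStep (hxA j) (hyA j) hnj
    have h2 := col_nonneg (y j)
    omega
  have hxfree : ∀ f : Fin 4, (x f).colevel ≠ 0 := by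
    intro f
    by_cases hfk : f = k
    · rw [hfk, hxk, hk]; norm_num
    by_cases hfj : f = j
    · rw [hfj]; exact hxj
    · rw [hs.1 f hfk hfj]; exact hch f hfj
  have h4 := (hB x hx hxfree).1 k
  rw [hxk, hk] at h4
  omega

/-- **(L2)** no supported P cell with an off-axis letter at `k` (`B` or `D`), a co-level-3 letter at `l`, a hub at `j`, and every
letter off `j` charged (block `{k, j}`: the consumer keeps the hub, lifts the `k` letter to a CHARGED letter (never to the hub), and is
an L1 cell).  Types: P BDHu, BCHu, DDHu, CDHu, BBDH, ABDH, … -/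
theorem noP_off2_col3_hub {h : ℤ} {D : Design} (hD : D.OnAlphabet h) (hr : RuleD D) (hdis : Disj D) (h3 : Ring3 D)
    (hB : HubfreePB D) {x : Cell} (hx : x ∈ D.suppP) {k l j : Fin 4} (hkj : k ≠ j) (hlj : l ≠ j) (hkl : k ≠ l)
    (hko : OffAxis (x k)) (hl3 : (x l).colevel = 3) (hj0 : (x j).colevel = 0)
    (hch : ∀ f : Fin 4, f ≠ j → (x f).colevel ≠ 0) : False := by
  have hxA : ∀ f : Fin 4, (x f).OnAlphabet h := hD x (LeggedFloor.mem_supp_of_memP D hx)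
  obtain ⟨y, hy, hs⟩ := ruleDP_any hr hx hkj
    (detects_of_col_ne_zero x k j (by have := two_le_colevel_of_offAxis _ hko; omega))
  have hyA : ∀ f : Fin 4, (y f).OnAlphabet h := hD y (LeggedFloor.mem_supp_of_memN D hy)
  have hyj : x j = y j := by
    rcases hs.2.2 with he | hn
    · exact he
    · exact absurd hn (not_nullStep_of_col_zero (hxA j) (hyA j) hj0)
  have hnk : NullStep (x k) (y k) := by
    rcases hs.2.1 with he | hn
    · exact (hdis x (by rw [cell_eq_of_supplies hs he hyj]; exact hy) hx).elim
    · exact hn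
  have hyk0 : (y k).colevel ≠ 0 := fun h0 => not_nullStep_hub_of_offAxis (hxA k) (hyA k) hko h0 hnk
  refine noN_col3_oneHub hD hr hdis h3 hB hy hlj ?_ ?_ ?_
  · rw [← hs.1 l hkl.symm hlj]; exact hl3
  · rw [← hyj]; exact hj0
  · intro f hfj
    by_cases hfk : f = k
    · rw [hfk]; exact hyk0
    · rw [← hs.1 f hfk hfj]; exact hch f hfj

/-- **(L3)** no supported N cell with a co-level-2 letter at `i`, an off-axis letter at `k`, a hub at `j`, and every letter off `j`
charged (types N ABHu, BBHu, ADHu′?, AABH, BBBH, ABDH, …) (block `{i, j}`: a supplier keeping the hub drops the `i` letter to co-level 3 — an L2 cell; a supplier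
moving the hub is hub-free with an off-axis letter and a col-2 letter: ¬(B)). -/
theorem noN_col2_off2_hub {h : ℤ} {D : Design} (hD : D.OnAlphabet h) (hr : RuleD D) (hdis : Disj D) (h3 : Ring3 D)
    (hB : HubfreePB D) {y : Cell} (hy : y ∈ D.suppN) {i k j : Fin 4} (hij : i ≠ j) (hkj : k ≠ j) (hik : i ≠ k)
    (hi2 : (y i).colevel = 2) (hko : OffAxis (y k)) (hj0 : (y j).colevel = 0)
    (hch : ∀ f : Fin 4, f ≠ j → (y f).colevel ≠ 0) : False := by
  have hyA : ∀ f : Fin 4, (y f).OnAlphabet h := hD y (LeggedFloor.mem_supp_of_memN D hy)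
  obtain ⟨x, hx, hs⟩ := ruleDN_any hr hy hij (detects_of_col_ne_zero y i j (by rw [hi2]; norm_num))
  have hxA : ∀ f : Fin 4, (x f).OnAlphabet h := hD x (LeggedFloor.mem_supp_of_memP D hx)
  have hxk : x k = y k := hs.1 k hik.symm hkj
  have hxko : OffAxis (x k) := by rw [hxk]; exact hko
  rcases hs.2.2 with hej | hnj
  · have hni : NullStep (x i) (y i) := by
      rcases hs.2.1 with he | hn
      · exact (hdis x (by rw [cell_eq_of_supplies hs he hej]; exact hy) hx).elim
      · exact hn
    have hxi3 : (x i).colevel = 3 := by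
      have h1 := col_lt_of_nullStep (hxA i) (hyA i) hni
      have h2 := h3 x (LeggedFloor.mem_supp_of_memP D hx) i
      omega
    refine noP_off2_col3_hub hD hr hdis h3 hB hx hkj hij hik.symm hxko hxi3 (by rw [hej]; exact hj0) ?_
    intro f hfj
    by_cases hfi : f = i
    · rw [hfi, hxi3]; norm_num
    · rw [hs.1 f hfi hfj]; exact hch f hfj
  · have hxj0 : (x j).colevel ≠ 0 := by
      have h1 := col_lt_of_nullStep (hxA j) (hyA j) hnj
      have h2 := col_nonneg (y j)
      omega
    have hxi2 : 2 ≤ (x i).colevel := by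
      have h1 := col_le_of_eq_or_null (hxA i) (hyA i) hs.2.1
      omega
    have hxfree : ∀ f : Fin 4, (x f).colevel ≠ 0 := by
      intro f
      by_cases hfi : f = i
      · rw [hfi]; omega
      by_cases hfj : f = j
      · rw [hfj]; exact hxj0
      · rw [hs.1 f hfi hfj]; exact hch f hfj
    have h4 := (hB x hx hxfree).2 k i hik.symm hxko
    omega

/-- **(L4)** no supported N cell with an off-axis letter at `k`, a co-level-3 letter at `l`, and hubs at `j` and `g` (N BDHH, BCHH,
DDHH, CDHH)
(block `{l, j}`: the supplier keeps the col-3 letter (ring 3), moves the hub at `j`, and is an L2 cell with hub `g`). -/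
theorem noN_col3_off2_HH {h : ℤ} {D : Design} (hD : D.OnAlphabet h) (hr : RuleD D) (hdis : Disj D) (h3 : Ring3 D)
    (hB : HubfreePB D) {y : Cell} (hy : y ∈ D.suppN) {k l j g : Fin 4} (hkl : k ≠ l) (hkj : k ≠ j) (hkg : k ≠ g)
    (hlj : l ≠ j) (hlg : l ≠ g) (hjg : j ≠ g) (hko : OffAxis (y k))
    (hl3 : (y l).colevel = 3) (hj0 : (y j).colevel = 0) (hg0 : (y g).colevel = 0) : False := by
  have hyA : ∀ f : Fin 4, (y f).OnAlphabet h := hD y (LeggedFloor.mem_supp_of_memN D hy)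
  obtain ⟨x, hx, hs⟩ := ruleDN_any hr hy hlj (detects_of_col_ne_zero y l j (by rw [hl3]; norm_num))
  have hxA : ∀ f : Fin 4, (x f).OnAlphabet h := hD x (LeggedFloor.mem_supp_of_memP D hx)
  have hxl : x l = y l := by
    rcases hs.2.1 with he | hn
    · exact he
    · exfalso
      have h1 := col_lt_of_nullStep (hxA l) (hyA l) hn
      have h2 := h3 x (LeggedFloor.mem_supp_of_memP D hx) l
      omega
  have hnj : NullStep (x j) (y j) := by
    rcases hs.2.2 with he | hn
    · exact (hdis x (by rw [cell_eq_of_supplies hs hxl he]; exact hy) hx).elim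
    · exact hn
  have hxj0 : (x j).colevel ≠ 0 := by
    have h1 := col_lt_of_nullStep (hxA j) (hyA j) hnj
    have h2 := col_nonneg (y j)
    omega
  have hxk : x k = y k := hs.1 k hkl hkj
  have hxg : x g = y g := hs.1 g hlg.symm hjg.symm
  refine noP_off2_col3_hub hD hr hdis h3 hB hx hkg hlg hkl (by rw [hxk]; exact hko) (by rw [hxl]; exact hl3)
    (by rw [hxg]; exact hg0) ?_
  intro f hfg
  by_cases hfl : f = l
  · rw [hfl, hxl, hl3]; norm_num
  by_cases hfj : f = j
  · rw [hfj]; exact hxj0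
  by_cases hfk : f = k
  · rw [hfk, hxk]; have := two_le_colevel_of_offAxis _ hko; omega
  exact (fin4_exhaust k l j g f hkl hkj hkg hlj hlg hjg hfk hfl hfj hfg).elim

/-- **(L5)** no supported P cell with a co-level-2 letter at `i`, off-axis letters at `k` and `l`, and a hub at `j` (P ABBH, BBBH,
ABDH, …)
(block `{l, j}`: the consumer keeps the hub, lifts the `l` letter to a unit, and is an L3 cell). -/
theorem noP_col2_off2_off2_hub {h : ℤ} {D : Design} (hD : D.OnAlphabet h) (hr : RuleD D) (hdis : Disj D) (h3 : Ring3 D)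
    (hB : HubfreePB D) {x : Cell} (hx : x ∈ D.suppP) {i k l j : Fin 4} (hik : i ≠ k) (hil : i ≠ l) (hij : i ≠ j)
    (hkl : k ≠ l) (hkj : k ≠ j) (hlj : l ≠ j) (hi2 : (x i).colevel = 2) (hko : OffAxis (x k))
    (hlo : OffAxis (x l)) (hj0 : (x j).colevel = 0) : False := by
  have hxA : ∀ f : Fin 4, (x f).OnAlphabet h := hD x (LeggedFloor.mem_supp_of_memP D hx)
  obtain ⟨y, hy, hs⟩ := ruleDP_any hr hx hlj
    (detects_of_col_ne_zero x l j (by have := two_le_colevel_of_offAxis _ hlo; omega))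
  have hyA : ∀ f : Fin 4, (y f).OnAlphabet h := hD y (LeggedFloor.mem_supp_of_memN D hy)
  have hyj : x j = y j := by
    rcases hs.2.2 with he | hn
    · exact he
    · exact absurd hn (not_nullStep_of_col_zero (hxA j) (hyA j) hj0)
  have hnl : NullStep (x l) (y l) := by
    rcases hs.2.1 with he | hn
    · exact (hdis x (by rw [cell_eq_of_supplies hs he hyj]; exact hy) hx).elim
    · exact hn
  have hyl0 : (y l).colevel ≠ 0 := fun h0 => not_nullStep_hub_of_offAxis (hxA l) (hyA l) hlo h0 hnl
  have hyi : x i = y i := hs.1 i hil hij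
  have hyk : x k = y k := hs.1 k hkl hkj
  refine noN_col2_off2_hub hD hr hdis h3 hB hy hij hkj hik (by rw [← hyi]; exact hi2) (by rw [← hyk]; exact hko)
    (by rw [← hyj]; exact hj0) ?_
  intro f hfj
  by_cases hfi : f = i
  · rw [hfi, ← hyi, hi2]; norm_num
  by_cases hfk : f = k
  · rw [hfk, ← hyk]; have := two_le_colevel_of_offAxis _ hko; omega
  by_cases hfl : f = l
  · rw [hfl]; exact hyl0
  exact (fin4_exhaust i k l j f hik hil hij hkl hkj hlj hfi hfk hfl hfj).elim


/-! ## §13 THE CELL-WEIGHT LAW AND THE P-MASS FLOOR (bus RESULT-5 ∕ CONFIRM of negation RESULT-6 §3, 2026-08-31) -/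

/-- the six letter KINDS of ring 3: hub `H` (co-level 0), unit `u` (1), `A`∕`B` = on∕off-axis co-level 2, `C`∕`D` = on∕off-axis co-level 3. -/
inductive Kind | H | u | A | B | C | D
  deriving DecidableEq, Fintype

/-- co-level of a kind. -/
def Kind.col : Kind → ℤ
  | .H => 0 | .u => 1 | .A => 2 | .B => 2 | .C => 3 | .D => 3

/-- `|x|·|y|` of a kind (`B ↦ 1`, `D ↦ 2`, on-axis kinds `↦ 0`). -/
def Kind.xy : Kind → ℤ
  | .B => 1 | .D => 2 | _ => 0

/-- off-axis flag of a kind. -/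
def Kind.off : Kind → Bool
  | .B => true | .D => true | _ => false

/-- a 4-vector of kinds. -/
def vec4 (a b c d : Kind) : Fin 4 → Kind
  | ⟨0, _⟩ => a | ⟨1, _⟩ => b | ⟨2, _⟩ => c | ⟨_, _⟩ => d

/-- kind-level mixed weight at the placement `(k; f, g)`. -/
def kpm (v : Fin 4 → Kind) (k f g : Fin 4) : ℤ := (v k).xy * ((v f).col * (v g).col)

/-- kind-level pair weight. -/
def kpw (v : Fin 4 → Kind) (g g' : Fin 4) : ℤ := (v g).xy * (v g').xy

/-- kind-level depth `Π col`. -/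
def kdep (v : Fin 4 → Kind) : ℤ := (v 0).col * (v 1).col * (v 2).col * (v 3).col

/-- the CELL WEIGHT at kind level: the twelve mixed weights + 2 × the six pair weights + 4 × the depth. -/
def KW (v : Fin 4 → Kind) : ℤ :=
  kpm v 0 1 2 + kpm v 0 1 3 + kpm v 0 2 3 + kpm v 1 0 2 + kpm v 1 0 3 + kpm v 1 2 3 +
  kpm v 2 0 1 + kpm v 2 0 3 + kpm v 2 1 3 + kpm v 3 0 1 + kpm v 3 0 2 + kpm v 3 1 2 +
  2 * (kpw v 0 1 + kpw v 0 2 + kpw v 0 3 + kpw v 1 2 + kpw v 1 3 + kpw v 2 3) + 4 * kdep v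

/-- (F1) at kind level: a hub-free vector has no off-axis kind, co-levels ≤ 2 and at most one kind of co-level 2. -/
abbrev KHubfree (v : Fin 4 → Kind) : Prop :=
  (∀ f : Fin 4, (v f).col ≠ 0) →
      (∀ f : Fin 4, (v f).off = false) ∧ (∀ f : Fin 4, (v f).col ≤ 2) ∧
      (∀ f g : Fin 4, f ≠ g → 2 ≤ (v f).col → (v g).col ≤ 1)

/-- (F2) at kind level: no «off-axis at `k` + co-level 3 at `l` + hub at `j` + every slot off `j` charged». -/
abbrev KNoOffCol3Hub (v : Fin 4 → Kind) : Prop :=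
  ∀ k l j : Fin 4, k ≠ j → l ≠ j → k ≠ l → (v k).off = true → (v l).col = 3 → (v j).col = 0 →
      (∀ f : Fin 4, f ≠ j → (v f).col ≠ 0) → False

/-- (F3) at kind level: no «co-level 2 at `i` + off-axis at `k` and at `l` + hub at `j`» (four distinct slots). -/
abbrev KNoCol2OffOffHub (v : Fin 4 → Kind) : Prop :=
  ∀ i k l j : Fin 4, i ≠ k → i ≠ l → i ≠ j → k ≠ l → k ≠ j → l ≠ j →
      (v i).col = 2 → (v k).off = true → (v l).off = true → (v j).col = 0 → False

set_option synthInstance.maxSize 4096 in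
set_option synthInstance.maxHeartbeats 400000 in
set_option maxHeartbeats 4000000 in
/-- **the kind-level cell-weight law**: under (F1)–(F3) every kind vector has weight `≤ 8` (`6⁴ = 1296` vectors, `decide`).
Equality at `AADH` (any order: one placement of mixed weight `2·2·2`), `DDHH` (pair weight `4`), `Auuu` (depth `2`). -/
theorem KW_le_eight : ∀ a b c d : Kind, KHubfree (vec4 a b c d) → KNoOffCol3Hub (vec4 a b c d) →
    KNoCol2OffOffHub (vec4 a b c d) → KW (vec4 a b c d) ≤ 8 := by
  decide

/-- the kind of a letter (meaningful for co-level `≤ 3`). -/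
def kindOf (ℓ : Letter) : Kind :=
  if ℓ.colevel = 0 then .H else if ℓ.colevel = 1 then .u
  else if ℓ.colevel = 2 then (if ℓ.x = 0 ∨ ℓ.y = 0 then .A else .B)
  else (if ℓ.x = 0 ∨ ℓ.y = 0 then .C else .D)

/-- the kind of a letter of co-level `≤ 3` records its co-level, its `|x|·|y|` and its off-axis flag. -/
theorem kindOf_spec (ℓ : Letter) (h3 : ℓ.colevel ≤ 3) :
    (kindOf ℓ).col = ℓ.colevel ∧ (kindOf ℓ).xy = |ℓ.x| * |ℓ.y| ∧ ((kindOf ℓ).off = true ↔ OffAxis ℓ) := by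
  have hx := abs_nonneg ℓ.x
  have hy := abs_nonneg ℓ.y
  have hcol : ℓ.colevel = |ℓ.x| + |ℓ.y| := rfl
  unfold kindOf OffAxis
  by_cases hxy : ℓ.x = 0 ∨ ℓ.y = 0
  · have hprod : |ℓ.x| * |ℓ.y| = 0 := by rcases hxy with h0 | h0 <;> simp [h0]
    have hnoff : ¬ (ℓ.x ≠ 0 ∧ ℓ.y ≠ 0) := fun hh => by
      rcases hxy with h0 | h0
      · exact hh.1 h0
      · exact hh.2 h0
    rcases (by omega : ℓ.colevel = 0 ∨ ℓ.colevel = 1 ∨ ℓ.colevel = 2 ∨ ℓ.colevel = 3) with hv | hv | hv | hv <;>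
      simp [hv, hxy, hprod, hnoff, Kind.col, Kind.xy, Kind.off]
  · have hxy2 : ℓ.x ≠ 0 ∧ ℓ.y ≠ 0 := by
      constructor
      · exact fun h0 => hxy (Or.inl h0)
      · exact fun h0 => hxy (Or.inr h0)
    have h1x : 1 ≤ |ℓ.x| := Int.one_le_abs hxy2.1
    have h1y : 1 ≤ |ℓ.y| := Int.one_le_abs hxy2.2
    rcases (by omega : ℓ.colevel = 2 ∨ ℓ.colevel = 3) with hv | hv
    · have hax : |ℓ.x| = 1 := by omega
      have hay : |ℓ.y| = 1 := by omega
      simp [hv, hax, hay, hxy2, Kind.col, Kind.xy, Kind.off]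
    · have hp : |ℓ.x| * |ℓ.y| = 2 := by
        rcases (by omega : (|ℓ.x| = 1 ∧ |ℓ.y| = 2) ∨ (|ℓ.x| = 2 ∧ |ℓ.y| = 1)) with ⟨ha, hb⟩ | ⟨ha, hb⟩ <;>
          rw [ha, hb] <;> norm_num
      simp [hv, hp, hxy2, Kind.col, Kind.xy, Kind.off]

/-- the kind vector of a cell. -/
def kvec (x : Cell) : Fin 4 → Kind := vec4 (kindOf (x 0)) (kindOf (x 1)) (kindOf (x 2)) (kindOf (x 3))

theorem kvec_apply (x : Cell) (f : Fin 4) : kvec x f = kindOf (x f) := by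
  fin_cases f <;> rfl

/-- the CELL WEIGHT `W(c) = Σ_{12 placements} pm + 2·Σ_{6 pairs} pw + 4·dep_h`. -/
def weight (h : ℤ) (c : Cell) : ℤ :=
  pm 0 1 2 c + pm 0 1 3 c + pm 0 2 3 c + pm 1 0 2 c + pm 1 0 3 c + pm 1 2 3 c +
  pm 2 0 1 c + pm 2 0 3 c + pm 2 1 3 c + pm 3 0 1 c + pm 3 0 2 c + pm 3 1 2 c +
  2 * (pw 0 1 c + pw 0 2 c + pw 0 3 c + pw 1 2 c + pw 1 3 c + pw 2 3 c) + 4 * dep h c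

/-- on the alphabet at ring 3 the cell weight is the kind-level weight of the kind vector. -/
theorem weight_eq_KW {h : ℤ} {c : Cell} (hc : ∀ f : Fin 4, (c f).OnAlphabet h) (h3 : ∀ f : Fin 4, (c f).colevel ≤ 3) :
    weight h c = KW (kvec c) := by
  have hcol : ∀ f : Fin 4, (kvec c f).col = (c f).colevel := fun f => by
    rw [kvec_apply]; exact (kindOf_spec (c f) (h3 f)).1
  have hxy : ∀ f : Fin 4, (kvec c f).xy = |(c f).x| * |(c f).y| := fun f => by
    rw [kvec_apply]; exact (kindOf_spec (c f) (h3 f)).2.1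
  unfold weight KW kpm kpw kdep pm pw
  rw [dep_eq_prod_colevel hc, Fin.prod_univ_four]
  simp only [hcol, hxy]

/-- «no hub-free supported P cell has an off-axis letter» — (B) together with «P Buuu = ∅» (DISPLAYED BINDER). -/
def NoOffHubfreeP (D : Design) : Prop :=
  ∀ x ∈ D.suppP, (∀ f : Fin 4, (x f).colevel ≠ 0) → ∀ f : Fin 4, ¬ OffAxis (x f)

/-- the (M1)-shape of hub-free P cells: next to a letter of co-level `≥ 2` every other letter is a unit («P AAuu = AAAu = AAAA = ∅»;
DISPLAYED BINDER; verbatim `ShellThreeDoorB.HubfreePAx1`). -/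
def HubfreePAx1 (D : Design) : Prop :=
  ∀ x ∈ D.suppP, (∀ f : Fin 4, (x f).colevel ≠ 0) → ∀ f g : Fin 4, f ≠ g → 2 ≤ (x f).colevel → (x g).colevel ≤ 1

/-- the coarse door restricts the kind vector of a supported P cell to (F1)–(F3). -/
theorem kinds_allowed {h : ℤ} {D : Design} (hD : D.OnAlphabet h) (hr : RuleD D) (hdis : Disj D) (h3 : Ring3 D)
    (hB : HubfreePB D) (hNO : NoOffHubfreeP D) (hA1 : HubfreePAx1 D) {x : Cell} (hx : x ∈ D.suppP) :
    KHubfree (kvec x) ∧ KNoOffCol3Hub (kvec x) ∧ KNoCol2OffOffHub (kvec x) := by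
  have h3x : ∀ f : Fin 4, (x f).colevel ≤ 3 := fun f => h3 x (LeggedFloor.mem_supp_of_memP D hx) f
  have hcol : ∀ f : Fin 4, (kvec x f).col = (x f).colevel := fun f => by
    rw [kvec_apply]; exact (kindOf_spec (x f) (h3x f)).1
  have hoff : ∀ f : Fin 4, (kvec x f).off = true ↔ OffAxis (x f) := fun f => by
    rw [kvec_apply]; exact (kindOf_spec (x f) (h3x f)).2.2
  refine ⟨?_, ?_, ?_⟩
  · intro hfree
    have hfree' : ∀ f : Fin 4, (x f).colevel ≠ 0 := fun f => by rw [← hcol f]; exact hfree f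
    refine ⟨fun f => ?_, fun f => ?_, fun f g hfg h2 => ?_⟩
    · have hn : ¬ OffAxis (x f) := hNO x hx hfree' f
      rw [← hoff f] at hn
      simpa using hn
    · rw [hcol]; exact (hB x hx hfree').1 f
    · rw [hcol] at h2 ⊢; exact hA1 x hx hfree' f g hfg h2
  · intro k l j hkj hlj hkl hko hl3 hj0 hch
    rw [hoff] at hko
    rw [hcol] at hl3 hj0
    exact noP_off2_col3_hub hD hr hdis h3 hB hx hkj hlj hkl hko hl3 hj0 fun f hf => by rw [← hcol f]; exact hch f hf
  · intro i k l j hik hil hij hkl hkj hlj hi2 hko hlo hj0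
    rw [hoff] at hko hlo
    rw [hcol] at hi2 hj0
    exact noP_col2_off2_off2_hub hD hr hdis h3 hB hx hik hil hij hkl hkj hlj hi2 hko hlo hj0

/-- **THE CELL-WEIGHT LAW**: every supported P cell has weight `≤ 8`. -/
theorem weight_le_eight {h : ℤ} {D : Design} (hD : D.OnAlphabet h) (hr : RuleD D) (hdis : Disj D) (h3 : Ring3 D)
    (hB : HubfreePB D) (hNO : NoOffHubfreeP D) (hA1 : HubfreePAx1 D) {x : Cell} (hx : x ∈ D.suppP) : weight h x ≤ 8 := by
  have hxA : ∀ f : Fin 4, (x f).OnAlphabet h := hD x (LeggedFloor.mem_supp_of_memP D hx)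
  have h3x : ∀ f : Fin 4, (x f).colevel ≤ 3 := fun f => h3 x (LeggedFloor.mem_supp_of_memP D hx) f
  obtain ⟨k1, k2, k3⟩ := kinds_allowed hD hr hdis h3 hB hNO hA1 hx
  rw [weight_eq_KW hxA h3x]
  exact KW_le_eight _ _ _ _ k1 k2 k3

/-- the P-mass `Σ_P m` as an integer. -/
theorem linZ_one_eq_massP (D : Design) : linZ D.P (fun _ => (1 : ℤ)) = (((D.P.map Prod.snd).sum : ℕ) : ℤ) := linZ_const_one D.P

/-- `Σ_P m·W` expanded into the nineteen mass functionals. -/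
theorem linZ_weight (h : ℤ) (L : List (Cell × ℕ)) :
    linZ L (weight h) =
      linZ L (pm 0 1 2) + linZ L (pm 0 1 3) + linZ L (pm 0 2 3) + linZ L (pm 1 0 2) + linZ L (pm 1 0 3) + linZ L (pm 1 2 3) +
      linZ L (pm 2 0 1) + linZ L (pm 2 0 3) + linZ L (pm 2 1 3) + linZ L (pm 3 0 1) + linZ L (pm 3 0 2) + linZ L (pm 3 1 2) +
      2 * (linZ L (pw 0 1) + linZ L (pw 0 2) + linZ L (pw 0 3) + linZ L (pw 1 2) + linZ L (pw 1 3) + linZ L (pw 2 3)) +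
      4 * linZ L (dep h) := by
  unfold weight
  simp only [linZ_add, linZ_smul]

/-- **THE P-MASS FLOOR** `13·(−E) ≤ 8·Σ_P m` under clause 1, the coarse door at ring 3 and the three displayed binders (height-free). -/
theorem thirteen_negE_le_eight_massP {h : ℤ} {D : Design} (hD : D.OnAlphabet h) (h1 : D.A1) (hr : RuleD D) (hdis : Disj D)
    (h3 : Ring3 D) (hB : HubfreePB D) (hNO : NoOffHubfreeP D) (hA1 : HubfreePAx1 D) :
    13 * (- E h D) ≤ 8 * (((D.P.map Prod.snd).sum : ℕ) : ℤ) := by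
  -- lower bounds, placement by placement
  have LBm : ∀ k f g : Fin 4, k ≠ f → k ≠ g → f ≠ g → - E h D ≤ 2 * linZ D.P (pm k f g) := by
    intro k f g hkf hkg hfg
    have hlaw := mid_law_alphabet hD h1 hkf hkg hfg
    have hN : 0 ≤ linZ D.N (pm k f g) := linZ_nonneg _ _ fun cm _ _ => pm_nonneg k f g cm.1
    linarith
  have LBw : ∀ g g' : Fin 4, g ≠ g' → - E h D ≤ 4 * linZ D.P (pw g g') := by
    intro g g' hne
    have hlaw := pair_law_alphabet hD h1 hne
    have hN : 0 ≤ linZ D.N (pw g g') := linZ_nonneg _ _ fun cm _ _ => pw_nonneg g g' cm.1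
    linarith
  have LBd : - E h D ≤ linZ D.P (dep h) := by
    have hN : 0 ≤ linZ D.N (dep h) := linZ_nonneg _ _ fun cm hm hp => dep_nonneg_alphabet (onAlphabet_of_N hD hm hp)
    have hE : E h D = linZ D.N (dep h) - linZ D.P (dep h) := rfl
    linarith
  have m012 := LBm 0 1 2 (by decide) (by decide) (by decide)
  have m013 := LBm 0 1 3 (by decide) (by decide) (by decide)
  have m023 := LBm 0 2 3 (by decide) (by decide) (by decide)
  have m102 := LBm 1 0 2 (by decide) (by decide) (by decide)
  have m103 := LBm 1 0 3 (by decide) (by decide) (by decide)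
  have m123 := LBm 1 2 3 (by decide) (by decide) (by decide)
  have m201 := LBm 2 0 1 (by decide) (by decide) (by decide)
  have m203 := LBm 2 0 3 (by decide) (by decide) (by decide)
  have m213 := LBm 2 1 3 (by decide) (by decide) (by decide)
  have m301 := LBm 3 0 1 (by decide) (by decide) (by decide)
  have m302 := LBm 3 0 2 (by decide) (by decide) (by decide)
  have m312 := LBm 3 1 2 (by decide) (by decide) (by decide)
  have w01 := LBw 0 1 (by decide)
  have w02 := LBw 0 2 (by decide)
  have w03 := LBw 0 3 (by decide)
  have w12 := LBw 1 2 (by decide)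
  have w13 := LBw 1 3 (by decide)
  have w23 := LBw 2 3 (by decide)
  -- upper bound, cell by cell
  have UB : linZ D.P (weight h) ≤ linZ D.P (fun _ => (8 : ℤ)) :=
    linZ_mono D.P (weight h) (fun _ => (8 : ℤ)) fun cm hm hp =>
      weight_le_eight hD hr hdis h3 hB hNO hA1 ((mem_suppP_iff D cm.1).mpr ⟨cm.2, by simpa using hm, hp⟩)
  have h8 : linZ D.P (fun _ => (8 : ℤ)) = 8 * (((D.P.map Prod.snd).sum : ℕ) : ℤ) := by
    rw [← linZ_one_eq_massP, ← linZ_smul]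
    simp
  have hexp := linZ_weight h D.P
  linarith

/-- **CONDITIONAL CLOSURE OF BRANCH B′** (shell 3, `Σ_P m ≤ 50`): the floor contradicts `E ≤ −32`, i.e. negation's balance-law
consequence (S3) «q = −E∕8 ≥ 4 in B′ under (M1)(M2)» — displayed here as the hypothesis `hS3`, NOT proved in this module. -/
theorem no_branchB_of_budget {h : ℤ} {D : Design} (hD : D.OnAlphabet h) (h1 : D.A1) (hr : RuleD D) (hdis : Disj D)
    (h3 : Ring3 D) (hB : HubfreePB D) (hNO : NoOffHubfreeP D) (hA1 : HubfreePAx1 D)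
    (hbud : (D.P.map Prod.snd).sum ≤ 50) (hS3 : E h D ≤ -32) : False := by
  have hfloor := thirteen_negE_le_eight_massP hD h1 hr hdis h3 hB hNO hA1
  have hb : (((D.P.map Prod.snd).sum : ℕ) : ℤ) ≤ 50 := by exact_mod_cast hbud
  linarith

/-- the same floor read as a bound on the class functional: `Σ_P m ≤ 50 ⟹ −30 ≤ E` (with `8 ∣ E` from `ShellThreePairLaw.lattice_digits`:
`E ≥ −24`, i.e. `q ≤ 3`). -/
theorem negE_le_thirty_of_budget {h : ℤ} {D : Design} (hD : D.OnAlphabet h) (h1 : D.A1) (hr : RuleD D) (hdis : Disj D)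
    (h3 : Ring3 D) (hB : HubfreePB D) (hNO : NoOffHubfreeP D) (hA1 : HubfreePAx1 D)
    (hbud : (D.P.map Prod.snd).sum ≤ 50) : -30 ≤ E h D := by
  have hfloor := thirteen_negE_le_eight_massP hD h1 hr hdis h3 hB hNO hA1
  have hb : (((D.P.map Prod.snd).sum : ℕ) : ℤ) ≤ 50 := by exact_mod_cast hbud
  linarith

/-! ### 13b. The H-bearing floor `9·(−E) ≤ 8·Σ_{P, hub} m` WITHOUT the (M1)-shape binder (meshes with negation's box-capacity lemma,
bus RESULT-8: `Σ_P m ≥ Σ_{P,HF} m + 9q`) -/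

/-- the H-BEARING WEIGHT at kind level: the twelve mixed weights + 2 × the six pair weights (no depth term). -/
def KWH (v : Fin 4 → Kind) : ℤ :=
  kpm v 0 1 2 + kpm v 0 1 3 + kpm v 0 2 3 + kpm v 1 0 2 + kpm v 1 0 3 + kpm v 1 2 3 +
  kpm v 2 0 1 + kpm v 2 0 3 + kpm v 2 1 3 + kpm v 3 0 1 + kpm v 3 0 2 + kpm v 3 1 2 +
  2 * (kpw v 0 1 + kpw v 0 2 + kpw v 0 3 + kpw v 1 2 + kpw v 1 3 + kpw v 2 3)

/-- `8` on a kind vector with a hub, `0` on a hub-free one. -/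
def khub (v : Fin 4 → Kind) : ℤ := if (v 0).col = 0 ∨ (v 1).col = 0 ∨ (v 2).col = 0 ∨ (v 3).col = 0 then 8 else 0

/-- (F1′) at kind level: a hub-free vector has no off-axis kind ((B) ∧ «P Buuu = ∅» only). -/
abbrev KHubfreeNoOff (v : Fin 4 → Kind) : Prop :=
  (∀ f : Fin 4, (v f).col ≠ 0) → ∀ f : Fin 4, (v f).off = false

set_option synthInstance.maxSize 4096 in
set_option synthInstance.maxHeartbeats 400000 in
set_option maxHeartbeats 4000000 in
/-- the kind-level H-bearing weight law: under (F1′), (F2), (F3) the H-bearing weight is `≤ 8` on vectors with a hub and `0` on hub-free ones. -/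
theorem KWH_le_khub : ∀ a b c d : Kind, KHubfreeNoOff (vec4 a b c d) → KNoOffCol3Hub (vec4 a b c d) →
    KNoCol2OffOffHub (vec4 a b c d) → KWH (vec4 a b c d) ≤ khub (vec4 a b c d) := by
  decide

/-- the H-BEARING CELL WEIGHT `W_H(c) = Σ_{12 placements} pm + 2·Σ_{6 pairs} pw`. -/
def weightH (c : Cell) : ℤ :=
  pm 0 1 2 c + pm 0 1 3 c + pm 0 2 3 c + pm 1 0 2 c + pm 1 0 3 c + pm 1 2 3 c +
  pm 2 0 1 c + pm 2 0 3 c + pm 2 1 3 c + pm 3 0 1 c + pm 3 0 2 c + pm 3 1 2 c +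
  2 * (pw 0 1 c + pw 0 2 c + pw 0 3 c + pw 1 2 c + pw 1 3 c + pw 2 3 c)

/-- the HUB INDICATOR ×8: `8` on a cell with a letter of co-level `0`, else `0`. -/
def hubEight (c : Cell) : ℤ := if (c 0).colevel = 0 ∨ (c 1).colevel = 0 ∨ (c 2).colevel = 0 ∨ (c 3).colevel = 0 then 8 else 0

theorem hubEight_nonneg (c : Cell) : 0 ≤ hubEight c := by
  unfold hubEight; split_ifs <;> norm_num

theorem hubEight_le (c : Cell) : hubEight c ≤ 8 := by
  unfold hubEight; split_ifs <;> norm_num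

theorem weightH_eq_KWH {c : Cell} (h3 : ∀ f : Fin 4, (c f).colevel ≤ 3) : weightH c = KWH (kvec c) := by
  have hcol : ∀ f : Fin 4, (kvec c f).col = (c f).colevel := fun f => by
    rw [kvec_apply]; exact (kindOf_spec (c f) (h3 f)).1
  have hxy : ∀ f : Fin 4, (kvec c f).xy = |(c f).x| * |(c f).y| := fun f => by
    rw [kvec_apply]; exact (kindOf_spec (c f) (h3 f)).2.1
  unfold weightH KWH kpm kpw pm pw
  simp only [hcol, hxy]

theorem hubEight_eq_khub {c : Cell} (h3 : ∀ f : Fin 4, (c f).colevel ≤ 3) : hubEight c = khub (kvec c) := by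
  have hcol : ∀ f : Fin 4, (kvec c f).col = (c f).colevel := fun f => by
    rw [kvec_apply]; exact (kindOf_spec (c f) (h3 f)).1
  unfold hubEight khub
  simp only [hcol]

/-- **THE H-BEARING CELL-WEIGHT LAW** (binders (B) and «P Buuu = ∅» only): `W_H(x) ≤ 8·[x has a hub]` for every supported P cell. -/
theorem weightH_le_hubEight {h : ℤ} {D : Design} (hD : D.OnAlphabet h) (hr : RuleD D) (hdis : Disj D) (h3 : Ring3 D)
    (hB : HubfreePB D) (hNO : NoOffHubfreeP D) {x : Cell} (hx : x ∈ D.suppP) : weightH x ≤ hubEight x := by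
  have h3x : ∀ f : Fin 4, (x f).colevel ≤ 3 := fun f => h3 x (LeggedFloor.mem_supp_of_memP D hx) f
  have hcol : ∀ f : Fin 4, (kvec x f).col = (x f).colevel := fun f => by
    rw [kvec_apply]; exact (kindOf_spec (x f) (h3x f)).1
  have hoff : ∀ f : Fin 4, (kvec x f).off = true ↔ OffAxis (x f) := fun f => by
    rw [kvec_apply]; exact (kindOf_spec (x f) (h3x f)).2.2
  have k1 : KHubfreeNoOff (kvec x) := by
    intro hfree f
    have hfree' : ∀ f : Fin 4, (x f).colevel ≠ 0 := fun f => by rw [← hcol f]; exact hfree f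
    have hn : ¬ OffAxis (x f) := hNO x hx hfree' f
    rw [← hoff f] at hn
    simpa using hn
  have k2 : KNoOffCol3Hub (kvec x) := by
    intro k l j hkj hlj hkl hko hl3 hj0 hch
    rw [hoff] at hko
    rw [hcol] at hl3 hj0
    exact noP_off2_col3_hub hD hr hdis h3 hB hx hkj hlj hkl hko hl3 hj0 fun f hf => by rw [← hcol f]; exact hch f hf
  have k3 : KNoCol2OffOffHub (kvec x) := by
    intro i k l j hik hil hij hkl hkj hlj hi2 hko hlo hj0
    rw [hoff] at hko hlo
    rw [hcol] at hi2 hj0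
    exact noP_col2_off2_off2_hub hD hr hdis h3 hB hx hik hil hij hkl hkj hlj hi2 hko hlo hj0
  rw [weightH_eq_KWH h3x, hubEight_eq_khub h3x]
  exact KWH_le_khub _ _ _ _ k1 k2 k3

theorem linZ_weightH (L : List (Cell × ℕ)) :
    linZ L weightH =
      linZ L (pm 0 1 2) + linZ L (pm 0 1 3) + linZ L (pm 0 2 3) + linZ L (pm 1 0 2) + linZ L (pm 1 0 3) + linZ L (pm 1 2 3) +
      linZ L (pm 2 0 1) + linZ L (pm 2 0 3) + linZ L (pm 2 1 3) + linZ L (pm 3 0 1) + linZ L (pm 3 0 2) + linZ L (pm 3 1 2) +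
      2 * (linZ L (pw 0 1) + linZ L (pw 0 2) + linZ L (pw 0 3) + linZ L (pw 1 2) + linZ L (pw 1 3) + linZ L (pw 2 3)) := by
  unfold weightH
  simp only [linZ_add, linZ_smul]

/-- **THE H-BEARING FLOOR** `9·(−E) ≤ Σ_P m·hubEight` (`= 8·Σ_{P, hub} m`): the P cells WITH A HUB carry mass `≥ 9q∕…`, precisely
`8·Σ_{P cells with a hub} m ≥ 9·(−E) = 72q` — binders (B) and «P Buuu = ∅» only; no (M1)-shape, no (M2). -/
theorem nine_negE_le_hubMassP {h : ℤ} {D : Design} (hD : D.OnAlphabet h) (h1 : D.A1) (hr : RuleD D) (hdis : Disj D)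
    (h3 : Ring3 D) (hB : HubfreePB D) (hNO : NoOffHubfreeP D) : 9 * (- E h D) ≤ linZ D.P hubEight := by
  have LBm : ∀ k f g : Fin 4, k ≠ f → k ≠ g → f ≠ g → - E h D ≤ 2 * linZ D.P (pm k f g) := by
    intro k f g hkf hkg hfg
    have hlaw := mid_law_alphabet hD h1 hkf hkg hfg
    have hN : 0 ≤ linZ D.N (pm k f g) := linZ_nonneg _ _ fun cm _ _ => pm_nonneg k f g cm.1
    linarith
  have LBw : ∀ g g' : Fin 4, g ≠ g' → - E h D ≤ 4 * linZ D.P (pw g g') := by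
    intro g g' hne
    have hlaw := pair_law_alphabet hD h1 hne
    have hN : 0 ≤ linZ D.N (pw g g') := linZ_nonneg _ _ fun cm _ _ => pw_nonneg g g' cm.1
    linarith
  have m012 := LBm 0 1 2 (by decide) (by decide) (by decide)
  have m013 := LBm 0 1 3 (by decide) (by decide) (by decide)
  have m023 := LBm 0 2 3 (by decide) (by decide) (by decide)
  have m102 := LBm 1 0 2 (by decide) (by decide) (by decide)
  have m103 := LBm 1 0 3 (by decide) (by decide) (by decide)
  have m123 := LBm 1 2 3 (by decide) (by decide) (by decide)
  have m201 := LBm 2 0 1 (by decide) (by decide) (by decide)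
  have m203 := LBm 2 0 3 (by decide) (by decide) (by decide)
  have m213 := LBm 2 1 3 (by decide) (by decide) (by decide)
  have m301 := LBm 3 0 1 (by decide) (by decide) (by decide)
  have m302 := LBm 3 0 2 (by decide) (by decide) (by decide)
  have m312 := LBm 3 1 2 (by decide) (by decide) (by decide)
  have w01 := LBw 0 1 (by decide)
  have w02 := LBw 0 2 (by decide)
  have w03 := LBw 0 3 (by decide)
  have w12 := LBw 1 2 (by decide)
  have w13 := LBw 1 3 (by decide)
  have w23 := LBw 2 3 (by decide)
  have UB : linZ D.P weightH ≤ linZ D.P hubEight :=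
    linZ_mono D.P weightH hubEight fun cm hm hp =>
      weightH_le_hubEight hD hr hdis h3 hB hNO ((mem_suppP_iff D cm.1).mpr ⟨cm.2, by simpa using hm, hp⟩)
  have hexp := linZ_weightH D.P
  linarith

/-- the H-bearing floor with the total mass split off: `9·(−E) + 8·Σ_{P, hub-free} m ≤ 8·Σ_P m`
(`Σ_{P, hub-free} m = Σ_P m·(8 − hubEight)∕8`). -/
theorem nine_negE_add_hubfreeMass_le {h : ℤ} {D : Design} (hD : D.OnAlphabet h) (h1 : D.A1) (hr : RuleD D) (hdis : Disj D)
    (h3 : Ring3 D) (hB : HubfreePB D) (hNO : NoOffHubfreeP D) :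
    9 * (- E h D) + linZ D.P (fun c => 8 - hubEight c) ≤ 8 * (((D.P.map Prod.snd).sum : ℕ) : ℤ) := by
  have hfl := nine_negE_le_hubMassP hD h1 hr hdis h3 hB hNO
  have hsplit : linZ D.P (fun c => 8 - hubEight c) = linZ D.P (fun _ => (8 : ℤ)) - linZ D.P hubEight := by
    have e : (fun c => 8 - hubEight c) = (fun c => (8 : ℤ) + (-1) * hubEight c) := by
      funext c; ring
    rw [e, linZ_add, linZ_smul]
    ring
  have h8 : linZ D.P (fun _ => (8 : ℤ)) = 8 * (((D.P.map Prod.snd).sum : ℕ) : ℤ) := by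
    rw [← linZ_one_eq_massP, ← linZ_smul]
    simp
  linarith

end PropagationB

end Summit.HodgeConjecture.HodgeConjecture.Cruxes.BlochSeedDiscOne.ShellThreeFloorB
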